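import Summits.QuantumFields.YangMills.Theorems.UnitScaleTiltProp7H46GradRowT3
import Summits.QuantumFields.YangMills.Theorems.UnitScaleTiltProp7NMax19Algebra
import Summits.QuantumFields.YangMills.Theorems.UnitScaleTiltProp7SectET3Objects
import Summits.QuantumFields.YangMills.Theorems.UnitScaleTiltProp7Bound20SymLog
import Literature.MathematicalPhysics.QuantumFieldTheory.Balaban1983to89.B11Prop3Model
import HarnessLib

/-!
# Route `UnitScaleTilt`, crux «MinimiserStabilityRegPr» (stmt-QuantumFields-19200, stub EX `stub_existenceMinimalOrbit`), route (α), node N06(d = 3) —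
# **THE ORDERS 0 AND 1 OF THE (19)-SIZE ROW `hSize19′` AT THE LETTER** ([Balaban1985Variational] (ii) p. 299 «|A′₁|, |∇_{U₀}A′₁| < ε₂ = O(1)C₁B₃ε₁», zeroth∕first order):
# for the chart exponent `X = −i·(A′ − H·D(A′))`, `A′ = ηi·(ιA₁ + ι(H₁B))`, the two members `‖X(b)‖∕η` and `‖∇¹_{U₀}X‖∕η²` of `Prop7TPrint.nMax19 U₀ X` are bounded by an EXPLICIT
# multiple of `C₁B₃ε₁ = L³·3L·ε₁` — from Prop. 6's a-priori size of the solution of (111), (103) + (20), the (115) → (19) dictionary ✓`Prop7H46GradRow` and (55) `|D(A′)| ≤ 4C₂|A′|²`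

Cell `ym3-torus` (HUMAN RULING D-0037, YM ladder rung R3 — YM₃ on T³ is a rung, NOT d = 4, NOT a mass gap, NOT Clay), width seat `ym3-torus-px18` (gen 0; OFFER «px18: SIZE19-ORD01»).
THEOREMS ONLY (0 `def`, 0 `sorry`); `--supports stmt-QuantumFields-19200 --as helper`; count-neutral.  An assembly of landed rows; the curved letters `𝔊`, `(δ∕δA′)V`, `H₁`, `H` and the
chart map `C` stay ABSTRACT with their displayed bounds (the EX knit's `norm_G`, `prop4`, `norm_H₁`, `h46₀` + the gradient row `h46∇` of ✓`Prop7H46GradRow`, `Chart47` as `QuadAnalytic`).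

THE PRINT.  [Balaban1985Variational] p. 299: *«the configuration A′₁ = A₁ + H₁B satisfies (ii) … |A′₁|, |∇_{U₀}A′₁|, |Δ_{U₀}A′₁|, |D*_{U₀}D_{U₀}A′₁| < ε₂ … ε₂ = O(1)C₁B₃ε₁»*; the zeroth and
first order come from (116) p. 295 *«ε₄ = 3B₀C₁B₃ε₁»* (the size of the unique solution of (111) in the space (115), Prop. 6), (103) p. 293 `A′ = A₁ + H₁B` with (117) `|H₁B| ≤ B₀|B|` and
(20) p. 281 `|B| < 2dLC₁ε₁`, (46) p. 285 `|HB|, |∇_{U₀}HB| ≤ B₀|B|`, and (55) p. 286 `|D(A′)| ≤ 4C₂|A′|²` for the chart (47)–(49) `(1∕iη) log U₁ = A′ − HD(A′)`.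

WHAT IS PROVED (ns `…Theorems.Prop7Size19Orders01`).
* §1 ★★ `orders01_of_sizes` — PURE DICTIONARY + (55): at a member `(F n K)`, background `U₀`, for ANY two (115)-letters `f₁ f₂` with `‖f₁‖ < s₁`, `‖f₂‖ ≤ s₂`, any linear `H` with the
  (46) rows `‖HY‖ ≤ BH·η·‖Y‖`, `‖∇¹_{U₀}(HY)‖ ≤ BH·η²·‖Y‖`, any chart map `C` quadratic-analytic `(C₂, R)` with the contraction windows of ✓`B11Prop3Model.Dfix_spec`
  (`9C₂(BHη)εb < 1`, `3εb ≤ R`, `η(s₁+s₂) ≤ εb`): with `A′ := (η·i)•(ιf₁ + ιf₂)`, `X := b ↦ (−i)•(A′ − H(Dfix C H C₂ A′))(b)` and `m := (s₁+s₂) + 4·BH·C₂·η²·(s₁+s₂)²`,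
  `‖X b‖ ≤ m·η` and `‖covGradT 1 (bgUnits U₀) X μ ν x‖ ≤ m·η²` (the first two members of `nMax19 U₀ X` are `≤ m`, ✓`Prop7NMax19Algebra.nMax19_le_iff` letters).
* §2 ★★★ `orders01_of_eq111_T3` — THE JUNCTION AT THE KNIT'S LETTERS: `f₁ := A₁` the displayed solution of (111) (`‖A₁‖ < r`, `A₁ + 𝔊J(U₀) + 𝔊W(A₁ + H₁B̃) = 0` with the CONCRETE
  current `Jcur (bgOfCfg F K U₀)`), `f₂ := H₁B̃` with the concrete datum `B̃ c = −i·mlog(V c·Ū₀(c)*)`, under `hSize19′`'s own guards `RegPr … (L³·3L·ε₁) U₀`, `CloseAvg … (L³ε₁) V U₀`,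
  `L³·3L·ε₁`-windows: `s₁ := 3B₀·L³·3L·ε₁` by Prop. 6's UNIQUENESS + SIZE (✓`Prop7SectET3Objects.prop6_bgOfCfg`, (116)), `s₂ := B₀·(2·3L·L³ε₁)` by (117) + (20)
  (✓`Prop7Bound20SymLog.bound20_symLog_of_closeAvg`) ⇒ the two members of `nMax19` for the knit's `X` VERBATIM (abstract `𝒢 W H₁ H C`) are `≤ m` with
  `m = (11B₀ + 4·BH·C₂·η²·(11B₀)²·(L³·3L·ε₁))·(L³·3L·ε₁)` — print's `O(1)·C₁B₃ε₁` at orders 0, 1, the `O(1)` explicit.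
HONEST SCOPE.  Orders 2 (`covCodiffCurlT`, `covLapFormT` members: (127)–(140), `hΔsol`∕`hΔH`) are NOT touched; `hSize19′` is NOT closed here; every letter bound is a displayed
hypothesis of the EX knit with its supplier of record (N06(d = 3) ∕ P4 ∕ KH1); nothing here claims EX, the crux, V3∕R3, d = 4 or the mass gap.

References: T. Bałaban, CMP **102** (1985) 277–309 [Balaban1985Variational] ((19) p.281, (20) p.281, (46)–(49) p.285, (55) p.286, (103) p.293, (111) p.294, (115)–(117) pp.294–295,
Prop. 6 p.295, (ii) p.299); CMP **99** (1985) 389–434 [Balaban1985BackgroundPropagators] ((3.3) p.391, (3.133) p.422).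
-/

set_option autoImplicit false

noncomputable section

open scoped Matrix.Norms.L2Operator BigOperators

namespace Summit.QuantumFields.YangMills.Theorems.Prop7Size19Orders01

open Literature.MathematicalPhysics.QuantumFieldTheory.Balaban1983to89
open Literature.MathematicalPhysics.QuantumFieldTheory.Balaban1983to89.T3ContinuumYM3Torus
open Literature.MathematicalPhysics.QuantumFieldTheory.Balaban1983to89.T3PrintedRegularMinimiser (RegPr)
open Literature.MathematicalPhysics.QuantumFieldTheory.Balaban1983to89.T3UnitLawDensityEML (ℰp)
open Literature.MathematicalPhysics.QuantumFieldTheory.Balaban1983to89.T3TiltDescent (descendTo)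
open T3SectALandauChart (eta eta_pos bgUnits covGradT CloseAvg)
open B9SectCLatticeCarrier (Bond)
open B11Eq115Space (NegSize NegSup Space115 JetSup)
open B11Eq111FrakG (nabla115)
open B11Eq98CurrentSlot (Jcur norm_Jcur_le)
open B11Prop3Model (Dfix Dfix_spec)
open B13Contraction113 (QuadAnalytic)
open MatrixLog (mlog)
open Summit.QuantumFields.YangMills.Theorems.Prop7SectET3Transport (periodsT3 bondEquiv bgOfCfg isUnitaryBg_bgOfCfg)
open Summit.QuantumFields.YangMills.Theorems.Prop7SectET3Objects (inU2cur_bgOfCfg_of_regPr prop6_bgOfCfg)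
open Summit.QuantumFields.YangMills.Theorems.Prop7Bound20SymLog (bound20_symLog_of_closeAvg)
open Summit.QuantumFields.YangMills.Theorems.Prop7NMax19Algebra (covGradT_sub covGradT_smul_complex)
open Summit.QuantumFields.YangMills.Theorems.Prop7H46GradRow (orders01_of_eta_smul_iota covGradT_one_smul)

variable (F : T3Family) (n K : ℕ) [Fact (0 < (F.L : ℝ))] [Fact (0 < ((F.L : ℝ)⁻¹) ^ (K - n))]

/-! ## §1 The dictionary step: orders 0, 1 of the chart exponent from the sizes of its two (115)-pieces -/

omit [Fact (0 < (F.L : ℝ))] [Fact (0 < ((F.L : ℝ)⁻¹) ^ (K - n))] in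
/-- The route reading `ι` is additive: `ι(f₁ + f₂) = ιf₁ + ιf₂` (pointwise; the space (115) carries the `Pi` addition). [cite: Balaban1985Variational, (115) p.294] -/
theorem iota_add (U₀ : GaugeField (F.P K) 0 (Matrix.specialUnitaryGroup (Fin 2) ℂ))
    (f₁ f₂ : Space115 (F.L : ℝ) (((F.L : ℝ)⁻¹) ^ (K - n)) (fun _ : Bond 3 (periodsT3 F K) => K - n) (fun _ : Bond 3 (periodsT3 F K) × Fin 3 => K - n)
      (nabla115 (((F.L : ℝ)⁻¹) ^ (K - n)) (bgOfCfg F K U₀))) :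
    ((fun b : PBond (F.P K) 0 => JetSup.equiv _ _ _ f₁ (bondEquiv F K b)) + fun b : PBond (F.P K) 0 => JetSup.equiv _ _ _ f₂ (bondEquiv F K b)) =
      fun b : PBond (F.P K) 0 => JetSup.equiv _ _ _ (f₁ + f₂) (bondEquiv F K b) := rfl

set_option maxHeartbeats 400000 in
/-- ★★ **ORDERS 0, 1 OF THE CHART EXPONENT FROM THE SIZES OF ITS TWO (115)-PIECES** (module docstring §1): `X = −i·(A′ − H·D(A′))`, `A′ = ηi·(ιf₁ + ιf₂)`;
`‖X b‖ ≤ m·η`, `‖∇¹_{U₀}X‖ ≤ m·η²`, `m = s + 4·BH·C₂·η²·s²`, `s = s₁ + s₂`. [cite: Balaban1985Variational, (47)–(49) p.285, (55) p.286, (46) p.285, (115) p.294, (19) p.281] -/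
theorem orders01_of_sizes (U₀ : GaugeField (F.P K) 0 (Matrix.specialUnitaryGroup (Fin 2) ℂ))
    (H : (PBond (F.P n) 0 → Matrix (Fin 2) (Fin 2) ℂ) →ₗ[ℂ] (PBond (F.P K) 0 → Matrix (Fin 2) (Fin 2) ℂ))
    (Ct : (PBond (F.P K) 0 → Matrix (Fin 2) (Fin 2) ℂ) → (PBond (F.P n) 0 → Matrix (Fin 2) (Fin 2) ℂ))
    {BH C₂ R εb s₁ s₂ : ℝ} (hBH : 0 ≤ BH) (hC₂ : 0 ≤ C₂)
    (h46₀ : ∀ Y, ‖H Y‖ ≤ BH * eta F n K * ‖Y‖)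
    (h46₁ : ∀ (Y : PBond (F.P n) 0 → Matrix (Fin 2) (Fin 2) ℂ) (μ ν : Fin (F.P K).d) (x : Site (F.P K) 0),
      ‖covGradT 1 (bgUnits F K U₀) (H Y) μ ν x‖ ≤ BH * eta F n K ^ 2 * ‖Y‖)
    (hC : QuadAnalytic Ct C₂ R) (hq : 9 * C₂ * (BH * eta F n K) * εb < 1) (hR : 3 * εb ≤ R) (hεb : eta F n K * (s₁ + s₂) ≤ εb)
    (f₁ f₂ : Space115 (F.L : ℝ) (((F.L : ℝ)⁻¹) ^ (K - n)) (fun _ : Bond 3 (periodsT3 F K) => K - n) (fun _ : Bond 3 (periodsT3 F K) × Fin 3 => K - n)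
      (nabla115 (((F.L : ℝ)⁻¹) ^ (K - n)) (bgOfCfg F K U₀)))
    (hf₁ : ‖f₁‖ < s₁) (hf₂ : ‖f₂‖ ≤ s₂) :
    (∀ b : PBond (F.P K) 0,
      ‖(-Complex.I) • ((((eta F n K : ℝ) : ℂ) * Complex.I) • ((fun b : PBond (F.P K) 0 => JetSup.equiv _ _ _ f₁ (bondEquiv F K b))
            + (fun b : PBond (F.P K) 0 => JetSup.equiv _ _ _ f₂ (bondEquiv F K b)))
          - H (Dfix Ct H C₂ ((((eta F n K : ℝ) : ℂ) * Complex.I) • ((fun b : PBond (F.P K) 0 => JetSup.equiv _ _ _ f₁ (bondEquiv F K b))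
            + (fun b : PBond (F.P K) 0 => JetSup.equiv _ _ _ f₂ (bondEquiv F K b)))))) b‖
        ≤ ((s₁ + s₂) + 4 * BH * C₂ * eta F n K ^ 2 * (s₁ + s₂) ^ 2) * eta F n K) ∧
    (∀ (μ ν : Fin (F.P K).d) (x : Site (F.P K) 0),
      ‖covGradT 1 (bgUnits F K U₀) (fun b : PBond (F.P K) 0 =>
          (-Complex.I) • ((((eta F n K : ℝ) : ℂ) * Complex.I) • ((fun b : PBond (F.P K) 0 => JetSup.equiv _ _ _ f₁ (bondEquiv F K b))
            + (fun b : PBond (F.P K) 0 => JetSup.equiv _ _ _ f₂ (bondEquiv F K b)))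
          - H (Dfix Ct H C₂ ((((eta F n K : ℝ) : ℂ) * Complex.I) • ((fun b : PBond (F.P K) 0 => JetSup.equiv _ _ _ f₁ (bondEquiv F K b))
            + (fun b : PBond (F.P K) 0 => JetSup.equiv _ _ _ f₂ (bondEquiv F K b)))))) b) μ ν x‖
        ≤ ((s₁ + s₂) + 4 * BH * C₂ * eta F n K ^ 2 * (s₁ + s₂) ^ 2) * eta F n K ^ 2) := by
  have hη : 0 < eta F n K := eta_pos F n K
  set η : ℝ := eta F n K with hηdef
  set s : ℝ := s₁ + s₂ with hsdef
  -- the two (115)-pieces as ONE letter `f := f₁ + f₂`, of size `< s`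
  set f := f₁ + f₂ with hfdef
  have hfs : ‖f‖ < s := (norm_add_le f₁ f₂).trans_lt (add_lt_add_of_lt_of_le hf₁ hf₂)
  have hs0 : 0 ≤ s := (norm_nonneg f).trans hfs.le
  set A' : PBond (F.P K) 0 → Matrix (Fin 2) (Fin 2) ℂ :=
    (((eta F n K : ℝ) : ℂ) * Complex.I) • ((fun b : PBond (F.P K) 0 => JetSup.equiv _ _ _ f₁ (bondEquiv F K b))
      + (fun b : PBond (F.P K) 0 => JetSup.equiv _ _ _ f₂ (bondEquiv F K b))) with hA'def
  have hA'f : A' = (((eta F n K : ℝ) : ℂ) * Complex.I) • fun b : PBond (F.P K) 0 => JetSup.equiv _ _ _ f (bondEquiv F K b) := by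
    rw [hA'def, iota_add]
  -- orders 0, 1 of `A′` by the generic ι-dictionary (`c = i`, `‖i‖ = 1`)
  have hI : ‖(Complex.I : ℂ)‖ ≤ 1 := by rw [Complex.norm_I]
  obtain ⟨hA'0, hA'1⟩ := orders01_of_eta_smul_iota F n K U₀ f Complex.I hI
  have hA'0' : ∀ b, ‖A' b‖ ≤ η * s := fun b => by
    rw [hA'f]; exact (hA'0 b).trans (mul_le_mul_of_nonneg_left hfs.le hη.le)
  have hA'1' : ∀ μ ν x, ‖covGradT 1 (bgUnits F K U₀) A' μ ν x‖ ≤ η ^ 2 * s := fun μ ν x => by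
    rw [hA'f]; exact (hA'1 μ ν x).trans (mul_le_mul_of_nonneg_left hfs.le (by positivity))
  have hA'norm : ‖A'‖ < εb := by
    have h1 : ‖A'‖ ≤ η * ‖f‖ := by
      refine (pi_norm_le_iff_of_nonneg (by positivity)).mpr fun b => ?_
      rw [hA'f]; exact hA'0 b
    calc ‖A'‖ ≤ η * ‖f‖ := h1
      _ < η * s := mul_lt_mul_of_pos_left hfs hη
      _ ≤ εb := hεb
  -- (55): the size of `D(A′)`
  set D := Dfix Ct H C₂ A' with hDdef
  have hHop : ∀ Y, ‖H Y‖ ≤ BH * η * ‖Y‖ := h46₀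
  have hD : ‖D‖ ≤ 4 * C₂ * ‖A'‖ ^ 2 := (Dfix_spec hC hC₂ (by positivity) hHop hq hR hA'norm).1
  have hA'le : ‖A'‖ ≤ η * s := (pi_norm_le_iff_of_nonneg (by positivity)).mpr hA'0'
  have hD' : ‖D‖ ≤ 4 * C₂ * (η * s) ^ 2 :=
    hD.trans (mul_le_mul_of_nonneg_left (pow_le_pow_left₀ (norm_nonneg _) hA'le 2) (by positivity))
  have hHD0 : ∀ b, ‖H D b‖ ≤ BH * η * (4 * C₂ * (η * s) ^ 2) := fun b =>
    (norm_le_pi_norm (H D) b).trans ((hHop D).trans (mul_le_mul_of_nonneg_left hD' (by positivity)))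
  have hHD1 : ∀ μ ν x, ‖covGradT 1 (bgUnits F K U₀) (H D) μ ν x‖ ≤ BH * η ^ 2 * (4 * C₂ * (η * s) ^ 2) := fun μ ν x =>
    (h46₁ D μ ν x).trans (mul_le_mul_of_nonneg_left hD' (by positivity))
  refine ⟨fun b => ?_, fun μ ν x => ?_⟩
  · -- order 0
    have e1 : (-Complex.I) • (A' - H D) b = (-Complex.I) • (A' b - H D b) := rfl
    rw [e1, norm_smul, norm_neg, Complex.norm_I, one_mul]
    calc ‖A' b - H D b‖ ≤ ‖A' b‖ + ‖H D b‖ := norm_sub_le _ _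
      _ ≤ η * s + BH * η * (4 * C₂ * (η * s) ^ 2) := add_le_add (hA'0' b) (hHD0 b)
      _ = (s + 4 * BH * C₂ * η ^ 2 * s ^ 2) * η := by ring
  · -- order 1
    have e1 : (fun b : PBond (F.P K) 0 => (-Complex.I) • (A' - H D) b) = (-Complex.I) • (A' - H D) := rfl
    rw [e1, covGradT_one_smul, covGradT_sub, norm_smul, norm_neg, Complex.norm_I, one_mul]
    calc ‖covGradT 1 (bgUnits F K U₀) A' μ ν x - covGradT 1 (bgUnits F K U₀) (H D) μ ν x‖
        ≤ ‖covGradT 1 (bgUnits F K U₀) A' μ ν x‖ + ‖covGradT 1 (bgUnits F K U₀) (H D) μ ν x‖ := norm_sub_le _ _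
      _ ≤ η ^ 2 * s + BH * η ^ 2 * (4 * C₂ * (η * s) ^ 2) := add_le_add (hA'1' μ ν x) (hHD1 μ ν x)
      _ = (s + 4 * BH * C₂ * η ^ 2 * s ^ 2) * η ^ 2 := by ring

/-! ## §2 The junction at the knit's letters: Prop. 6's size of `A₁`, (103) + (20) for `H₁B̃` -/

set_option maxHeartbeats 400000 in
/-- ★★★ **ORDERS 0, 1 OF `hSize19′` AT THE LETTER** (module docstring §2): for the displayed solution `A₁` of (111) and the datum `B̃ = −i·log(VŪ₀*)`, under `hSize19′`'s guards,
the members `‖X b‖∕η`, `‖∇¹_{U₀}X‖∕η²` of the knit's chart exponent `X` are `≤ m`, `m = (11B₀ + 4·BH·C₂·η²·(11B₀)²·(L³·3L·ε₁))·(L³·3L·ε₁)`; the letters `𝔊 W H₁ H C` abstract with their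
displayed rows, Prop. 6's windows in its own letters (`ε₄ := r`). [cite: Balaban1985Variational, (ii) p.299, Prop. 6 p.295, (116) p.295, (103) p.293, (117) p.295, (20) p.281, (46) p.285, (55) p.286, (19) p.281] -/
theorem orders01_of_eq111_T3 (h : n ≤ K) (U₀ : GaugeField (F.P K) 0 (Matrix.specialUnitaryGroup (Fin 2) ℂ))
    (V : GaugeField (F.P n) 0 (Matrix.specialUnitaryGroup (Fin 2) ℂ))
    (𝒢 : NegSize (F.L : ℝ) (((F.L : ℝ)⁻¹) ^ (K - n)) (fun _ : Bond 3 (periodsT3 F K) => K - n) 3 (Matrix (Fin 2) (Fin 2) ℂ) →L[ℂ]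
          Space115 (F.L : ℝ) (((F.L : ℝ)⁻¹) ^ (K - n)) (fun _ : Bond 3 (periodsT3 F K) => K - n) (fun _ : Bond 3 (periodsT3 F K) × Fin 3 => K - n)
            (nabla115 (((F.L : ℝ)⁻¹) ^ (K - n)) (bgOfCfg F K U₀)))
    (W : Space115 (F.L : ℝ) (((F.L : ℝ)⁻¹) ^ (K - n)) (fun _ : Bond 3 (periodsT3 F K) => K - n) (fun _ : Bond 3 (periodsT3 F K) × Fin 3 => K - n)
            (nabla115 (((F.L : ℝ)⁻¹) ^ (K - n)) (bgOfCfg F K U₀)) →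
          NegSize (F.L : ℝ) (((F.L : ℝ)⁻¹) ^ (K - n)) (fun _ : Bond 3 (periodsT3 F K) => K - n) 3 (Matrix (Fin 2) (Fin 2) ℂ))
    (H₁ : (PBond (F.P n) 0 → Matrix (Fin 2) (Fin 2) ℂ) →L[ℂ]
          Space115 (F.L : ℝ) (((F.L : ℝ)⁻¹) ^ (K - n)) (fun _ : Bond 3 (periodsT3 F K) => K - n) (fun _ : Bond 3 (periodsT3 F K) × Fin 3 => K - n)
            (nabla115 (((F.L : ℝ)⁻¹) ^ (K - n)) (bgOfCfg F K U₀)))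
    (H : (PBond (F.P n) 0 → Matrix (Fin 2) (Fin 2) ℂ) →ₗ[ℂ] (PBond (F.P K) 0 → Matrix (Fin 2) (Fin 2) ℂ))
    (Ct : (PBond (F.P K) 0 → Matrix (Fin 2) (Fin 2) ℂ) → (PBond (F.P n) 0 → Matrix (Fin 2) (Fin 2) ℂ))
    {B₀ C₄ a₃ BH C₂ R εb r ε₁ : ℝ} (hB₀ : 0 < B₀) (hC₄ : 0 < C₄) (hBH : 0 ≤ BH) (hC₂ : 0 ≤ C₂) (hε₁ : 0 < ε₁)
    -- the displayed letter rows (N06(d = 3) ∕ P4 ∕ KH1 + the gradient row of ✓`Prop7H46GradRow`)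
    (norm_G : ∀ f, ‖𝒢 f‖ ≤ B₀ * ‖f‖) (quad : QuadAnalytic W C₄ a₃) (norm_H₁ : ∀ b, ‖H₁ b‖ ≤ B₀ * ‖b‖)
    (h46₀ : ∀ Y, ‖H Y‖ ≤ BH * eta F n K * ‖Y‖)
    (h46₁ : ∀ (Y : PBond (F.P n) 0 → Matrix (Fin 2) (Fin 2) ℂ) (μ ν : Fin (F.P K).d) (x : Site (F.P K) 0),
      ‖covGradT 1 (bgUnits F K U₀) (H Y) μ ν x‖ ≤ BH * eta F n K ^ 2 * ‖Y‖)
    -- the chart (47) as a quadratic-analytic map and the contraction windows of (55) (the knit's `Chart47`, `hq47`, `hR6`, `hrε2` after arithmetic)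
    (hC : QuadAnalytic Ct C₂ R) (hq : 9 * C₂ * (BH * eta F n K) * εb < 1) (hR : 3 * εb ≤ R)
    (hεb : eta F n K * (3 * B₀ * ((F.L : ℝ) ^ 3 * (3 * (F.L : ℝ)) * ε₁) + B₀ * (2 * ((3 : ℝ) * F.L) * ((F.L : ℝ) ^ 3 * ε₁))) ≤ εb)
    -- Prop. 6's windows in its own letters, `ε₄ := r`, `C₁ := L³`, `B₃ := 3L` (the knit: `hrα` + `L³·3L·ε₁ ≤ α`, `hr4`, `hr16`)
    (h1 : 2 * B₀ * (F.L : ℝ) ^ 3 * (3 * (F.L : ℝ)) * ε₁ ≤ r) (h2 : 4 * r ≤ a₃) (h3 : 16 * B₀ * C₄ * r ≤ 1)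
    -- `hSize19′`'s own guards
    (hreg : RegPr F n K ((F.L : ℝ) ^ 3 * (3 * (F.L : ℝ)) * ε₁) U₀) (hclose : CloseAvg F n K h ((F.L : ℝ) ^ 3 * ε₁) V U₀) (hwin : (F.L : ℝ) ^ 3 * ε₁ ≤ 1 / 2)
    -- the displayed solution of (111)
    (A₁ : Space115 (F.L : ℝ) (((F.L : ℝ)⁻¹) ^ (K - n)) (fun _ : Bond 3 (periodsT3 F K) => K - n) (fun _ : Bond 3 (periodsT3 F K) × Fin 3 => K - n)
      (nabla115 (((F.L : ℝ)⁻¹) ^ (K - n)) (bgOfCfg F K U₀)))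
    (hA₁ : ‖A₁‖ < r)
    (heq : A₁ + 𝒢 (Jcur (bgOfCfg F K U₀)) + 𝒢 (W (A₁ + H₁ (fun c : PBond (F.P n) 0 =>
          (-Complex.I) • mlog (((V c : Matrix.specialUnitaryGroup (Fin 2) ℂ) : Matrix (Fin 2) (Fin 2) ℂ)
            * star ((descendTo F ℰp n K h U₀ c : Matrix.specialUnitaryGroup (Fin 2) ℂ) : Matrix (Fin 2) (Fin 2) ℂ))))) = 0) :
    (∀ b : PBond (F.P K) 0,
      ‖(-Complex.I) • ((((eta F n K : ℝ) : ℂ) * Complex.I) • ((fun b : PBond (F.P K) 0 => JetSup.equiv _ _ _ A₁ (bondEquiv F K b))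
            + (fun b : PBond (F.P K) 0 => JetSup.equiv _ _ _ (H₁ (fun c : PBond (F.P n) 0 =>
          (-Complex.I) • mlog (((V c : Matrix.specialUnitaryGroup (Fin 2) ℂ) : Matrix (Fin 2) (Fin 2) ℂ)
            * star ((descendTo F ℰp n K h U₀ c : Matrix.specialUnitaryGroup (Fin 2) ℂ) : Matrix (Fin 2) (Fin 2) ℂ)))) (bondEquiv F K b)))
          - H (Dfix Ct H C₂ ((((eta F n K : ℝ) : ℂ) * Complex.I) • ((fun b : PBond (F.P K) 0 => JetSup.equiv _ _ _ A₁ (bondEquiv F K b))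
            + (fun b : PBond (F.P K) 0 => JetSup.equiv _ _ _ (H₁ (fun c : PBond (F.P n) 0 =>
          (-Complex.I) • mlog (((V c : Matrix.specialUnitaryGroup (Fin 2) ℂ) : Matrix (Fin 2) (Fin 2) ℂ)
            * star ((descendTo F ℰp n K h U₀ c : Matrix.specialUnitaryGroup (Fin 2) ℂ) : Matrix (Fin 2) (Fin 2) ℂ)))) (bondEquiv F K b)))))) b‖
        ≤ ((11 * B₀ + 4 * BH * C₂ * eta F n K ^ 2 * (11 * B₀) ^ 2 * ((F.L : ℝ) ^ 3 * (3 * (F.L : ℝ)) * ε₁)) * ((F.L : ℝ) ^ 3 * (3 * (F.L : ℝ)) * ε₁)) * eta F n K) ∧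
    (∀ (μ ν : Fin (F.P K).d) (x : Site (F.P K) 0),
      ‖covGradT 1 (bgUnits F K U₀) (fun b : PBond (F.P K) 0 =>
          (-Complex.I) • ((((eta F n K : ℝ) : ℂ) * Complex.I) • ((fun b : PBond (F.P K) 0 => JetSup.equiv _ _ _ A₁ (bondEquiv F K b))
            + (fun b : PBond (F.P K) 0 => JetSup.equiv _ _ _ (H₁ (fun c : PBond (F.P n) 0 =>
          (-Complex.I) • mlog (((V c : Matrix.specialUnitaryGroup (Fin 2) ℂ) : Matrix (Fin 2) (Fin 2) ℂ)
            * star ((descendTo F ℰp n K h U₀ c : Matrix.specialUnitaryGroup (Fin 2) ℂ) : Matrix (Fin 2) (Fin 2) ℂ)))) (bondEquiv F K b)))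
          - H (Dfix Ct H C₂ ((((eta F n K : ℝ) : ℂ) * Complex.I) • ((fun b : PBond (F.P K) 0 => JetSup.equiv _ _ _ A₁ (bondEquiv F K b))
            + (fun b : PBond (F.P K) 0 => JetSup.equiv _ _ _ (H₁ (fun c : PBond (F.P n) 0 =>
          (-Complex.I) • mlog (((V c : Matrix.specialUnitaryGroup (Fin 2) ℂ) : Matrix (Fin 2) (Fin 2) ℂ)
            * star ((descendTo F ℰp n K h U₀ c : Matrix.specialUnitaryGroup (Fin 2) ℂ) : Matrix (Fin 2) (Fin 2) ℂ)))) (bondEquiv F K b)))))) b) μ ν x‖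
        ≤ ((11 * B₀ + 4 * BH * C₂ * eta F n K ^ 2 * (11 * B₀) ^ 2 * ((F.L : ℝ) ^ 3 * (3 * (F.L : ℝ)) * ε₁)) * ((F.L : ℝ) ^ 3 * (3 * (F.L : ℝ)) * ε₁)) * eta F n K ^ 2) := by
  have hL : 0 < (F.L : ℝ) := Fact.out
  set ρ : ℝ := (F.L : ℝ) ^ 3 * (3 * (F.L : ℝ)) * ε₁ with hρdef
  have hρ : 0 < ρ := by positivity
  -- (20): the datum `B̃` is small, `‖B̃‖ < 2·3L·(L³ε₁) = 2ρ`
  set Bt : PBond (F.P n) 0 → Matrix (Fin 2) (Fin 2) ℂ := fun c : PBond (F.P n) 0 =>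
    (-Complex.I) • mlog (((V c : Matrix.specialUnitaryGroup (Fin 2) ℂ) : Matrix (Fin 2) (Fin 2) ℂ)
      * star ((descendTo F ℰp n K h U₀ c : Matrix.specialUnitaryGroup (Fin 2) ℂ) : Matrix (Fin 2) (Fin 2) ℂ)) with hBtdef
  have hBt : ‖Bt‖ < 2 * ((3 : ℝ) * F.L) * ((F.L : ℝ) ^ 3 * ε₁) := bound20_symLog_of_closeAvg F h hε₁ hwin V U₀ hclose
  have h2ρ : 2 * ((3 : ℝ) * F.L) * ((F.L : ℝ) ^ 3 * ε₁) = 2 * ρ := by rw [hρdef]; ring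
  -- (103)∕(117): `‖H₁B̃‖ ≤ B₀‖B̃‖ < 2B₀ρ`
  have h𝔄 : ‖H₁ Bt‖ < 2 * ((3 : ℝ) * F.L) * B₀ * (F.L : ℝ) ^ 3 * ε₁ := by
    calc ‖H₁ Bt‖ ≤ B₀ * ‖Bt‖ := norm_H₁ Bt
      _ < B₀ * (2 * ((3 : ℝ) * F.L) * ((F.L : ℝ) ^ 3 * ε₁)) := mul_lt_mul_of_pos_left hBt hB₀
      _ = 2 * ((3 : ℝ) * F.L) * B₀ * (F.L : ℝ) ^ 3 * ε₁ := by ring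
  have h𝔄' : ‖H₁ Bt‖ ≤ B₀ * (2 * ((3 : ℝ) * F.L) * ((F.L : ℝ) ^ 3 * ε₁)) := by
    calc ‖H₁ Bt‖ ≤ B₀ * ‖Bt‖ := norm_H₁ Bt
      _ ≤ B₀ * (2 * ((3 : ℝ) * F.L) * ((F.L : ℝ) ^ 3 * ε₁)) := mul_le_mul_of_nonneg_left hBt.le hB₀.le
  -- Prop. 6 (116): the displayed solution IS the unique one, of size `< 3B₀C₁B₃ε₁ = 3B₀ρ`
  have hreg' : RegPr F n K ((F.L : ℝ) ^ 3 * (3 * (F.L : ℝ)) * ε₁) U₀ := hreg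
  have h1' : 2 * B₀ * (F.L : ℝ) ^ 3 * (3 * (F.L : ℝ)) * ε₁ ≤ r := h1
  obtain ⟨A, -, -, hAsize, huniq⟩ := prop6_bgOfCfg F K n U₀ (𝒢 := 𝒢) (W := W) norm_G quad hB₀ hC₄ (by positivity : (0 : ℝ) < (F.L : ℝ) ^ 3)
    (by positivity : (0 : ℝ) < 3 * (F.L : ℝ)) hε₁ (le_refl _) h1' h2 h3 hreg' (𝔄 := H₁ Bt) h𝔄
  have hA₁eq : A₁ = A := huniq A₁ hA₁ heq
  have hA₁size : ‖A₁‖ < 3 * B₀ * ρ := by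
    rw [hA₁eq]; calc ‖A‖ < 3 * B₀ * (F.L : ℝ) ^ 3 * (3 * (F.L : ℝ)) * ε₁ := hAsize
      _ = 3 * B₀ * ρ := by rw [hρdef]; ring
  -- §1 at `s₁ := 3B₀ρ`, `s₂ := B₀·2ρ`
  have hεb' : eta F n K * (3 * B₀ * ρ + B₀ * (2 * ((3 : ℝ) * F.L) * ((F.L : ℝ) ^ 3 * ε₁))) ≤ εb := hεb
  obtain ⟨h0, h1o⟩ := orders01_of_sizes F n K U₀ H Ct hBH hC₂ h46₀ h46₁ hC hq hR hεb' A₁ (H₁ Bt) hA₁size h𝔄'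
  have hs : 3 * B₀ * ρ + B₀ * (2 * ((3 : ℝ) * F.L) * ((F.L : ℝ) ^ 3 * ε₁)) = 5 * B₀ * ρ := by rw [h2ρ]; ring
  have hη : 0 < eta F n K := eta_pos F n K
  -- `5B₀ρ + 4·BH·C₂·η²·(5B₀ρ)² ≤ (11B₀ + 4·BH·C₂·η²·(11B₀)²·ρ)·ρ`
  have hmono : (3 * B₀ * ρ + B₀ * (2 * ((3 : ℝ) * F.L) * ((F.L : ℝ) ^ 3 * ε₁))) +
      4 * BH * C₂ * eta F n K ^ 2 * (3 * B₀ * ρ + B₀ * (2 * ((3 : ℝ) * F.L) * ((F.L : ℝ) ^ 3 * ε₁))) ^ 2 ≤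
      (11 * B₀ + 4 * BH * C₂ * eta F n K ^ 2 * (11 * B₀) ^ 2 * ρ) * ρ := by
    rw [hs]
    have hB : 0 ≤ B₀ := hB₀.le
    have hK : 0 ≤ 4 * BH * C₂ * eta F n K ^ 2 := by positivity
    nlinarith [mul_nonneg hK (by positivity : (0 : ℝ) ≤ B₀ ^ 2 * ρ ^ 2), mul_nonneg hB hρ.le]
  refine ⟨fun b => (h0 b).trans ?_, fun μ ν x => (h1o μ ν x).trans ?_⟩
  · exact mul_le_mul_of_nonneg_right hmono hη.le
  · exact mul_le_mul_of_nonneg_right hmono (by positivity)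

end Summit.QuantumFields.YangMills.Theorems.Prop7Size19Orders01

end
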